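import Summits.NavierStokesRegularity.NavierStokesRegularity.Theorems.SoloSalvageWu2026HarmonicCutoff
import HarnessLib

/-!
# C177 `Wu2026` — SALVAGE (TRUE column): `step_382 : Step_382` — the harmonic cut-off inequality (3.82)
# `∫ Φ_R ν|∇v|² ≤ −R ∫_{|x|>R} 𝒬 v·x |x|^{−3}` by one dominated-convergence limit

Cell `ns-claims` (D-0090), lane ns-claims-salvage-p6 g5 (handover of salvage-p3 g6's CLOSING §); records-
grade for the row (#164 «discharges», KIT NONE). Assembly of `SoloSalvageWu2026{CutoffProfile, CutoffRadial,
HarmonicCutoff}`: with `ε_n = (n+1)⁻¹`, `L_n = 2R+2+n`, `h_n = radialProfile R ε_n`, `χ_n` the energy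
cut-off at scale `L_n`, the tested inequalities `ν∫h_nχ_n|∇v|² ≤ ∫F_n` (`tested_le`) pass to the limit:
`h_nχ_n → Φ_R` pointwise with `0 ≤ h_nχ_n ≤ 1`, `|∇v|² ∈ L¹`; `F_n → −R𝟙_{|x|>R}𝒬⟪v,x⟩|x|^{−3}`
pointwise (eventually constant in `n` at every `x`: the cut-off freezes at `1`, the ramp at `1`), with
`|F_n| ≤ 𝟙_{|x|>R}[(ν/2)R(C₂+6C₁)|v|²|x|^{−3} + R(1+C₁)(|q||v|+|v|³)|x|^{−2}] ∈ L¹`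
(`integrable_dominator`). Hence `cutoffEnergy ν R v ≤ current382 R v (p − c)` (`cutoffEnergy_le_current382`),
and with salvage-p3 g6's `integrableOn_current` (3.73)–(3.74) the typed binder `Step_382` holds.
[cite: Wu2026, (3.72)–(3.82) p.23–25; Remark 3.5 p.26]

WHAT THIS IS NOT: not a claim about NS regularity or blow-up; not a claim about any author beyond the
typed locator.
-/

set_option linter.dupNamespace false

noncomputable section

open MeasureTheory Set Filter Topology InnerProductSpace Metric
open scoped RealInnerProductSpace Laplacian Topology ENNReal

namespace Summit.NavierStokesRegularity.NavierStokesRegularity.Theorems.Wu2026Salvage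

open Literature.Analysis.FluidPDE Literature.Analysis.FunctionSpaces Literature.Claims.NS.Wu2026

/-! ### §1 The energy cut-off: bounds in terms of `|x|` -/

/-- `‖Dχ_L(x)‖ ≤ C₁/|x|` for the energy cut-off at scale `L` (`‖Dχ_L‖ ≤ C₁/L`, supported in
`3L/4 ≤ |x| ≤ 7L/8 < L`). [cite: Wu2026, p.25 l.24 (|∇χ_L| ≤ C/L on A_L)] -/
theorem cutoff_norm_fderiv_le {L C₁ : ℝ} (hL : 0 < L) (hC₁ : 0 ≤ C₁) {χ : E3 → ℝ}
    (hD : ∀ x, ‖fderiv ℝ χ x‖ ≤ C₁ * L⁻¹)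
    (hoff : ∀ x : E3, ‖x‖ < 3 * L / 4 ∨ 7 * L / 8 < ‖x‖ → fderiv ℝ χ x = 0 ∧ (Δ χ) x = 0) (x : E3) :
    ‖fderiv ℝ χ x‖ ≤ C₁ / ‖x‖ := by
  by_cases h : ‖x‖ < 3 * L / 4 ∨ 7 * L / 8 < ‖x‖
  · rw [(hoff x h).1, norm_zero]; positivity
  · push Not at h
    have hx0 : 0 < ‖x‖ := lt_of_lt_of_le (by positivity) h.1
    have hLx : ‖x‖ ≤ L := by linarith [h.2]
    calc ‖fderiv ℝ χ x‖ ≤ C₁ * L⁻¹ := hD x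
      _ ≤ C₁ * ‖x‖⁻¹ := by gcongr
      _ = C₁ / ‖x‖ := (div_eq_mul_inv _ _).symm

/-- `|Δχ_L(x)| ≤ C₂/|x|²`. [cite: Wu2026, p.25 l.24 (|Δχ_L| ≤ C/L² on A_L)] -/
theorem cutoff_abs_laplacian_le {L C₂ : ℝ} (hL : 0 < L) (hC₂ : 0 ≤ C₂) {χ : E3 → ℝ}
    (hΔ : ∀ x, |(Δ χ) x| ≤ C₂ * L⁻¹ ^ 2)
    (hoff : ∀ x : E3, ‖x‖ < 3 * L / 4 ∨ 7 * L / 8 < ‖x‖ → fderiv ℝ χ x = 0 ∧ (Δ χ) x = 0) (x : E3) :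
    |(Δ χ) x| ≤ C₂ / ‖x‖ ^ 2 := by
  by_cases h : ‖x‖ < 3 * L / 4 ∨ 7 * L / 8 < ‖x‖
  · rw [(hoff x h).2, abs_zero]; positivity
  · push Not at h
    have hx0 : 0 < ‖x‖ := lt_of_lt_of_le (by positivity) h.1
    have hLx : ‖x‖ ≤ L := by linarith [h.2]
    calc |(Δ χ) x| ≤ C₂ * L⁻¹ ^ 2 := hΔ x
      _ ≤ C₂ * ‖x‖⁻¹ ^ 2 := by gcongr
      _ = C₂ / ‖x‖ ^ 2 := by rw [div_eq_mul_inv, inv_pow]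

/-! ### §2 The uniform bound `|F| ≤ G` -/

/-- **Uniform domination of the tested right-hand side.** For `h = radialProfile R ε` (any `ε > 0`)
and a cut-off `χ` with `0 ≤ χ ≤ 1`, `‖Dχ‖ ≤ C₁/|x|`, `|Δχ| ≤ C₂/|x|²`, `Dχ = Δχ = 0` on `B_{3L/4} ⊇ B̄_R`:
`|F(x)| ≤ 𝟙_{|x|>R}[(ν/2)(RC₂+6RC₁)|v|²|x|^{−3} + (RC₁+R)(|q||v| + |v|³)|x|^{−2}]` — the print's
annular bounds (3.73), p.25 l.21–30 with `Φ_R ≤ R/|x|`, `|∇Φ_R| ≤ R/|x|²`. [cite: Wu2026, (3.73) p.24; p.25 l.21–30] -/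
theorem abs_testedRHS_le {ν : ℝ} (hν : 0 < ν) (v : E3 → E3) (q : E3 → ℝ) {R ε : ℝ} (hR : 0 < R)
    (hε : 0 < ε) {L C₁ C₂ : ℝ} (hC₁ : 0 ≤ C₁) (hRL : R < 3 * L / 4) {χ : E3 → ℝ}
    (hχ01 : ∀ x, 0 ≤ χ x ∧ χ x ≤ 1) (hDχ : ∀ x, ‖fderiv ℝ χ x‖ ≤ C₁ / ‖x‖)
    (hΔχ : ∀ x, |(Δ χ) x| ≤ C₂ / ‖x‖ ^ 2)
    (hoff : ∀ x : E3, ‖x‖ < 3 * L / 4 → fderiv ℝ χ x = 0 ∧ (Δ χ) x = 0) (x : E3) :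
    |testedRHS ν v q (radialProfile R ε) χ x| ≤
      ({x : E3 | R < ‖x‖}).indicator (fun x => ν / 2 * (R * C₂ + 6 * R * C₁) * ‖v x‖ ^ 2 * (‖x‖ ^ 3)⁻¹ +
        (R * C₁ + R) * ((|q x| * ‖v x‖ + ‖v x‖ ^ 3) * (‖x‖ ^ 2)⁻¹)) x := by
  set h : E3 → ℝ := radialProfile R ε with hh
  set b := stdOrthonormalBasis ℝ E3 with hb
  by_cases hxR : R < ‖x‖
  · -- outside `B̄_R`
    rw [indicator_of_mem (show x ∈ {x : E3 | R < ‖x‖} from hxR)]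
    have hx0 : 0 < ‖x‖ := hR.trans hxR
    have hxne : x ≠ 0 := norm_pos_iff.1 hx0
    have hhx : 0 ≤ h x ∧ h x ≤ R / ‖x‖ :=
      ⟨(radialProfile_nonneg_le_one hR hε x).1, radialProfile_le_div hR hε hxne⟩
    have hDh : ∀ w, |fderiv ℝ h x w| ≤ R / ‖x‖ ^ 2 * ‖w‖ := fun w => abs_fderiv_radialProfile_le hR hε hxne w
    have hχx := hχ01 x
    -- the Laplacian part
    have hsum : |∑ i, fderiv ℝ h x (b i) * fderiv ℝ χ x (b i)| ≤ 3 * (R / ‖x‖ ^ 2 * (C₁ / ‖x‖)) := by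
      calc |∑ i, fderiv ℝ h x (b i) * fderiv ℝ χ x (b i)|
          ≤ ∑ i, |fderiv ℝ h x (b i) * fderiv ℝ χ x (b i)| := Finset.abs_sum_le_sum_abs _ _
        _ ≤ ∑ _i : Fin (Module.finrank ℝ E3), R / ‖x‖ ^ 2 * (C₁ / ‖x‖) := by
            refine Finset.sum_le_sum fun i _ => ?_
            rw [abs_mul]
            have h1 : |fderiv ℝ h x (b i)| ≤ R / ‖x‖ ^ 2 := by
              simpa [b.orthonormal.1 i] using hDh (b i)
            have h2 : |fderiv ℝ χ x (b i)| ≤ C₁ / ‖x‖ := by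
              rw [← Real.norm_eq_abs]
              calc ‖fderiv ℝ χ x (b i)‖ ≤ ‖fderiv ℝ χ x‖ * ‖b i‖ := ContinuousLinearMap.le_opNorm _ _
                _ = ‖fderiv ℝ χ x‖ := by rw [b.orthonormal.1 i, mul_one]
                _ ≤ C₁ / ‖x‖ := hDχ x
            exact mul_le_mul h1 h2 (abs_nonneg _) (by positivity)
        _ = 3 * (R / ‖x‖ ^ 2 * (C₁ / ‖x‖)) := by
            simp [Finset.sum_const, Finset.card_univ]
    have hlap : |h x * (Δ χ) x + 2 * ∑ i, fderiv ℝ h x (b i) * fderiv ℝ χ x (b i)| ≤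
        (R * C₂ + 6 * R * C₁) * (‖x‖ ^ 3)⁻¹ := by
      calc |h x * (Δ χ) x + 2 * ∑ i, fderiv ℝ h x (b i) * fderiv ℝ χ x (b i)|
          ≤ |h x * (Δ χ) x| + |2 * ∑ i, fderiv ℝ h x (b i) * fderiv ℝ χ x (b i)| := abs_add_le _ _
        _ ≤ R / ‖x‖ * (C₂ / ‖x‖ ^ 2) + 2 * (3 * (R / ‖x‖ ^ 2 * (C₁ / ‖x‖))) := by
            rw [abs_mul, abs_mul, abs_of_nonneg hhx.1, abs_of_nonneg (by norm_num : (0 : ℝ) ≤ 2)]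
            gcongr
            · exact hhx.2
            · exact hΔχ x
        _ = (R * C₂ + 6 * R * C₁) * (‖x‖ ^ 3)⁻¹ := by field_simp; ring
    -- the current part
    have hcur : |h x * fderiv ℝ χ x (v x) + χ x * fderiv ℝ h x (v x)| ≤ (R * C₁ + R) * (‖v x‖ * (‖x‖ ^ 2)⁻¹) := by
      calc |h x * fderiv ℝ χ x (v x) + χ x * fderiv ℝ h x (v x)|
          ≤ |h x * fderiv ℝ χ x (v x)| + |χ x * fderiv ℝ h x (v x)| := abs_add_le _ _
        _ ≤ R / ‖x‖ * (C₁ / ‖x‖ * ‖v x‖) + 1 * (R / ‖x‖ ^ 2 * ‖v x‖) := by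
            rw [abs_mul, abs_mul, abs_of_nonneg hhx.1, abs_of_nonneg hχx.1]
            gcongr
            · exact hhx.2
            · rw [← Real.norm_eq_abs]
              exact (ContinuousLinearMap.le_opNorm _ _).trans (mul_le_mul_of_nonneg_right (hDχ x) (norm_nonneg _))
            · exact hχx.2
            · exact hDh (v x)
        _ = (R * C₁ + R) * (‖v x‖ * (‖x‖ ^ 2)⁻¹) := by field_simp
    have hbern : |bern v q x| * ‖v x‖ ≤ |q x| * ‖v x‖ + ‖v x‖ ^ 3 := by
      have hb : |bern v q x| ≤ |q x| + ‖v x‖ ^ 2 := by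
        unfold bern
        refine (abs_add_le _ _).trans ?_
        rw [abs_of_nonneg (by positivity : (0 : ℝ) ≤ ‖v x‖ ^ 2 / 2)]
        nlinarith [sq_nonneg ‖v x‖]
      calc |bern v q x| * ‖v x‖ ≤ (|q x| + ‖v x‖ ^ 2) * ‖v x‖ := by gcongr
        _ = |q x| * ‖v x‖ + ‖v x‖ ^ 3 := by ring
    -- assemble
    unfold testedRHS
    calc |ν / 2 * ((h x * (Δ χ) x + 2 * ∑ i, fderiv ℝ h x (b i) * fderiv ℝ χ x (b i)) * ‖v x‖ ^ 2) +
          bern v q x * (h x * fderiv ℝ χ x (v x) + χ x * fderiv ℝ h x (v x))|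
        ≤ |ν / 2 * ((h x * (Δ χ) x + 2 * ∑ i, fderiv ℝ h x (b i) * fderiv ℝ χ x (b i)) * ‖v x‖ ^ 2)| +
          |bern v q x * (h x * fderiv ℝ χ x (v x) + χ x * fderiv ℝ h x (v x))| := abs_add_le _ _
      _ = ν / 2 * (|h x * (Δ χ) x + 2 * ∑ i, fderiv ℝ h x (b i) * fderiv ℝ χ x (b i)| * ‖v x‖ ^ 2) +
          |bern v q x| * |h x * fderiv ℝ χ x (v x) + χ x * fderiv ℝ h x (v x)| := by
          rw [abs_mul, abs_mul, abs_mul, abs_of_nonneg (by positivity : (0 : ℝ) ≤ ν / 2),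
            abs_of_nonneg (by positivity : (0 : ℝ) ≤ ‖v x‖ ^ 2)]
      _ ≤ ν / 2 * ((R * C₂ + 6 * R * C₁) * (‖x‖ ^ 3)⁻¹ * ‖v x‖ ^ 2) +
          |bern v q x| * ((R * C₁ + R) * (‖v x‖ * (‖x‖ ^ 2)⁻¹)) := by gcongr
      _ = ν / 2 * (R * C₂ + 6 * R * C₁) * ‖v x‖ ^ 2 * (‖x‖ ^ 3)⁻¹ +
          (R * C₁ + R) * ((|bern v q x| * ‖v x‖) * (‖x‖ ^ 2)⁻¹) := by ring
      _ ≤ ν / 2 * (R * C₂ + 6 * R * C₁) * ‖v x‖ ^ 2 * (‖x‖ ^ 3)⁻¹ +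
          (R * C₁ + R) * ((|q x| * ‖v x‖ + ‖v x‖ ^ 3) * (‖x‖ ^ 2)⁻¹) := by gcongr
  · -- inside `B̄_R` everything vanishes
    rw [indicator_of_notMem (show x ∉ {x : E3 | R < ‖x‖} from hxR)]
    have hxR' : ‖x‖ ≤ R := not_lt.1 hxR
    have h1 := hoff x (lt_of_le_of_lt hxR' hRL)
    have h2 : fderiv ℝ h x (v x) = 0 := fderiv_radialProfile_eq_zero hR hε hxR' _
    have h3 : ∀ i, fderiv ℝ χ x (stdOrthonormalBasis ℝ E3 i) = 0 := fun i => by rw [h1.1]; rfl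
    have h4 : fderiv ℝ χ x (v x) = 0 := by rw [h1.1]; rfl
    unfold testedRHS
    simp [h1.2, h2, h3, h4, Finset.sum_const_zero]

/-! ### §3 Continuity of the tested right-hand side -/

/-- `F` is continuous (hence measurable) for smooth data. [cite: Wu2026, (3.81) p.25] -/
theorem continuous_testedRHS {ν : ℝ} {v : E3 → E3} (hv : Continuous v) {q : E3 → ℝ} (hq : Continuous q)
    {h χ : E3 → ℝ} (hh : ContDiff ℝ 2 h) (hχ : ContDiff ℝ 2 χ) : Continuous (testedRHS ν v q h χ) := by
  have hh1 : ContDiff ℝ 1 h := hh.of_le one_le_two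
  have hχ1 : ContDiff ℝ 1 χ := hχ.of_le one_le_two
  have hDh : Continuous (fderiv ℝ h) := hh1.continuous_fderiv one_ne_zero
  have hDχ : Continuous (fderiv ℝ χ) := hχ1.continuous_fderiv one_ne_zero
  have hb : Continuous (bern v q) := by
    unfold bern; exact hq.add ((hv.norm.pow 2).div_const 2)
  unfold testedRHS
  refine (continuous_const.mul (((hh.continuous.mul (Literature.Analysis.FluidPDE.continuous_laplacian hχ)).add
    (continuous_const.mul (continuous_finsetSum _ fun i _ =>
      (hDh.clm_apply continuous_const).mul (hDχ.clm_apply continuous_const)))).mul (hv.norm.pow 2))).add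
    (hb.mul ((hh.continuous.mul (hDχ.clm_apply hv)).add (hχ.continuous.mul (hDh.clm_apply hv))))

/-! ### §4 The limit: `cutoffEnergy ≤ current382` -/

/-- `∫ 𝟙_{|x|>R}(−R 𝒬 ⟪v,x⟩ |x|^{−3}) = current382 R v q` (the limit integrand's integral).
[cite: Wu2026, (3.82) p.25 l.107–124] -/
theorem integral_indicator_current (R : ℝ) (v : E3 → E3) (q : E3 → ℝ) :
    ∫ x, ({x : E3 | R < ‖x‖}).indicator (fun x => -R * (bern v q x * ⟪v x, x⟫ / ‖x‖ ^ 3)) x =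
      current382 R v q := by
  unfold current382
  rw [integral_indicator (measurableSet_lt measurable_const measurable_norm), integral_const_mul, neg_mul]

/-- **(3.82) in the consumed form**: `∫ Φ_R ν|∇v|² ≤ −R ∫_{|x|>R} 𝒬 v·x |x|^{−3}` for an `IsWuFlow`
(`ν > 0`) with `D < ∞` and a pressure representative `p − c ∈ L^{9/4,∞}`. [cite: Wu2026, (3.72)–(3.82) p.23–25; Remark 3.5 p.26] -/
theorem cutoffEnergy_le_current382 {ν : ℝ} (hν : 0 < ν) {v : E3 → E3} {p : E3 → ℝ}
    (hflow : IsWuFlow ν v p) (hD : dirichlet v < ∞) {c : ℝ}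
    (hq : MemWeakLp (fun x => p x - c) ((9 : ℝ≥0∞) / 4) volume) {R : ℝ} (hR : 0 < R) :
    cutoffEnergy ν R v ≤ current382 R v (fun x => p x - c) := by
  set q : E3 → ℝ := fun x => p x - c with hqdef
  have hvc : Continuous v := hflow.smooth_v.continuous
  have hqc : Continuous q := hflow.smooth_p.continuous.sub continuous_const
  -- the energy density
  set e : E3 → ℝ := fun x => frobeniusNormSq (fderiv ℝ v x) with he
  have he_nonneg : ∀ x, 0 ≤ e x := fun x => frobeniusNormSq_nonneg _
  have he_cont : Continuous e := SereginWangProof.continuous_frobeniusNormSq_fderiv hflow.smooth_v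
  have he_int : Integrable e := by
    refine ⟨he_cont.aestronglyMeasurable, ?_⟩
    rw [hasFiniteIntegral_iff_ofReal (Eventually.of_forall he_nonneg)]
    exact hD
  -- the cut-offs
  obtain ⟨C₁, C₂, hC₁, hC₂, hcut⟩ := exists_energyCutoff (E := E3)
  set ε : ℕ → ℝ := fun n => 1 / ((n : ℝ) + 1) with hεdef
  set L : ℕ → ℝ := fun n => 2 * R + 2 + n with hLdef
  have hε : ∀ n, 0 < ε n := fun n => by rw [hεdef]; positivity
  have hL : ∀ n, 0 < L n := fun n => by rw [hLdef]; positivity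
  have hRL : ∀ n, R < 3 * L n / 4 := fun n => by
    have : (0 : ℝ) ≤ n := Nat.cast_nonneg n
    rw [hLdef]; linarith
  choose χ hχ using fun n => hcut (L n) (hL n)
  have hχ2 : ∀ n, ContDiff ℝ 2 (χ n) := fun n => (hχ n).1.of_le (by norm_cast)
  have hDχ : ∀ n x, ‖fderiv ℝ (χ n) x‖ ≤ C₁ / ‖x‖ := fun n =>
    cutoff_norm_fderiv_le (hL n) hC₁ (hχ n).2.2.2.2.2.1 (hχ n).2.2.2.2.2.2.2
  have hΔχ : ∀ n x, |(Δ (χ n)) x| ≤ C₂ / ‖x‖ ^ 2 := fun n =>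
    cutoff_abs_laplacian_le (hL n) hC₂ (hχ n).2.2.2.2.2.2.1 (hχ n).2.2.2.2.2.2.2
  have hoff : ∀ n (x : E3), ‖x‖ < 3 * L n / 4 → fderiv ℝ (χ n) x = 0 ∧ (Δ (χ n)) x = 0 :=
    fun n x hx => (hχ n).2.2.2.2.2.2.2 x (Or.inl hx)
  -- the two sequences
  set a : ℕ → ℝ := fun n => ∫ x, (radialProfile R (ε n) x * χ n x) * (ν * e x) with ha
  set F : ℕ → E3 → ℝ := fun n => testedRHS ν v q (radialProfile R (ε n)) (χ n) with hF
  have hab : ∀ n, a n ≤ ∫ x, F n x := fun n => by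
    have h := tested_le hν hflow hR (hε n) (hχ2 n) (hχ n).2.1 (fun x => ((hχ n).2.2.1 x).1) c
    have e1 : ν * ∫ x, radialProfile R (ε n) x * χ n x * frobeniusNormSq (fderiv ℝ v x) = a n := by
      rw [ha, ← integral_const_mul]
      refine integral_congr_ae (Eventually.of_forall fun x => ?_)
      show ν * (radialProfile R (ε n) x * χ n x * frobeniusNormSq (fderiv ℝ v x)) = _
      rw [he]; ring
    rw [← e1]; exact h
  -- (i) the left-hand side: `a n → cutoffEnergy`
  have hεlim : Tendsto ε atTop (𝓝 0) := by
    rw [hεdef]; exact tendsto_one_div_add_atTop_nhds_zero_nat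
  have hLlim : Tendsto L atTop atTop := by
    rw [hLdef]
    exact tendsto_atTop_add_const_left _ _ tendsto_natCast_atTop_atTop
  have hfreeze : ∀ x : E3, ∀ᶠ n in atTop, ‖x‖ < 3 * L n / 4 := fun x => by
    have h := hLlim.eventually (eventually_gt_atTop (4 * ‖x‖ / 3))
    filter_upwards [h] with n hn
    linarith
  have hplateau : Tendsto (fun n => profile R (ε n) (R ^ 2)) atTop (𝓝 1) := by
    have hlow : Tendsto (fun n => R / (R + ε n)) atTop (𝓝 1) := by
      have : Tendsto (fun n => R / (R + ε n)) atTop (𝓝 (R / (R + 0))) :=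
        tendsto_const_nhds.div (tendsto_const_nhds.add hεlim) (by rw [add_zero]; exact hR.ne')
      rwa [add_zero, div_self hR.ne'] at this
    exact tendsto_of_tendsto_of_tendsto_of_le_of_le hlow tendsto_const_nhds
      (fun n => (profile_sq_mem hR (hε n)).1) (fun n => (profile_sq_mem hR (hε n)).2)
  have hprof_lim : ∀ x : E3, Tendsto (fun n => radialProfile R (ε n) x) atTop (𝓝 (PhiR R x)) := by
    intro x
    by_cases hx : ‖x‖ ≤ R
    · have e1 : PhiR R x = 1 := by unfold PhiR; rw [if_pos hx]
      rw [e1]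
      refine hplateau.congr fun n => ?_
      exact (radialProfile_eq_plateau hR (hε n) hx).symm
    · have hx' : R < ‖x‖ := not_le.1 hx
      have e1 : PhiR R x = R / ‖x‖ := by unfold PhiR; rw [if_neg hx]
      rw [e1]
      refine (tendsto_const_nhds (x := R / ‖x‖)).congr' ?_
      have hev : ∀ᶠ n in atTop, ε n ≤ ‖x‖ - R :=
        hεlim.eventually (eventually_le_nhds (sub_pos.2 hx'))
      filter_upwards [hev] with n hn
      exact (radialProfile_eq_div hR (hε n) (by linarith)).symm
  have hA : Tendsto a atTop (𝓝 (cutoffEnergy ν R v)) := by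
    unfold cutoffEnergy
    refine tendsto_integral_of_dominated_convergence (fun x => ν * e x) ?_ (he_int.const_mul ν) ?_ ?_
    · intro n
      exact (((contDiff_radialProfile hR (hε n)).continuous.mul (hχ n).1.continuous).mul
        (continuous_const.mul he_cont)).aestronglyMeasurable
    · intro n
      refine Eventually.of_forall fun x => ?_
      have h1 := radialProfile_nonneg_le_one hR (hε n) x
      have h2 := (hχ n).2.2.1 x
      have hνe : 0 ≤ ν * e x := mul_nonneg hν.le (he_nonneg x)
      rw [norm_mul, Real.norm_eq_abs, Real.norm_eq_abs, abs_of_nonneg hνe,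
        abs_of_nonneg (mul_nonneg h1.1 h2.1)]
      exact mul_le_of_le_one_left hνe (mul_le_one₀ h1.2 h2.1 h2.2)
    · refine Eventually.of_forall fun x => ?_
      have hχlim : Tendsto (fun n => χ n x) atTop (𝓝 1) := by
        refine (tendsto_const_nhds (x := (1 : ℝ))).congr' ?_
        filter_upwards [hfreeze x] with n hn
        exact ((hχ n).2.2.2.1 x hn.le).symm
      simpa using ((hprof_lim x).mul hχlim).mul (tendsto_const_nhds (x := ν * e x))
  -- (ii) the right-hand side: `∫ F n → ∫ currentIntegrand = current382`
  set Fcur : E3 → ℝ := fun x =>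
    ({x : E3 | R < ‖x‖}).indicator (fun x => -R * (bern v q x * ⟪v x, x⟫ / ‖x‖ ^ 3)) x with hFcur
  have hF_lim : ∀ x : E3, Tendsto (fun n => F n x) atTop (𝓝 (Fcur x)) := by
    intro x
    refine (tendsto_const_nhds (x := Fcur x)).congr' ?_
    by_cases hxR : R < ‖x‖
    · have hx0 : 0 < ‖x‖ := hR.trans hxR
      have hev : ∀ᶠ n in atTop, ε n ≤ ‖x‖ - R :=
        hεlim.eventually (eventually_le_nhds (sub_pos.2 hxR))
      filter_upwards [hfreeze x, hev] with n hn hn'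
      have h1 := hoff n x hn
      have h2 : χ n x = 1 := (hχ n).2.2.2.1 x hn.le
      have h3 : rampDens R (ε n) (‖x‖ ^ 2) = (‖x‖ ^ 2) ^ (-(3 / 2 : ℝ)) :=
        rampDens_eq_rpow hR (hε n) (pow_le_pow_left₀ (by linarith [hε n]) (by linarith) 2)
      have h4 : ∀ i, fderiv ℝ (χ n) x (stdOrthonormalBasis ℝ E3 i) = 0 := fun i => by rw [h1.1]; rfl
      have h5 : fderiv ℝ (χ n) x (v x) = 0 := by rw [h1.1]; rfl
      have h6 : (‖x‖ ^ 2 : ℝ) ^ (-(3 / 2 : ℝ)) = (‖x‖ ^ 3)⁻¹ := by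
        rw [Real.rpow_neg (by positivity), show (‖x‖ ^ 2 : ℝ) = ‖x‖ ^ (2 : ℝ) by norm_cast,
          ← Real.rpow_mul hx0.le, show (2 : ℝ) * (3 / 2) = (3 : ℕ) by norm_num, Real.rpow_natCast]
      simp only [hF, hFcur, indicator_of_mem (show x ∈ {x : E3 | R < ‖x‖} from hxR)]
      simp only [testedRHS, h1.2, h4, h5, h2, mul_zero, zero_add, Finset.sum_const_zero, add_zero,
        zero_mul, one_mul, fderiv_radialProfile_apply hR (hε n), h3, h6, real_inner_comm x (v x)]
      field_simp
    · filter_upwards [] with n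
      have hxR' : ‖x‖ ≤ R := not_lt.1 hxR
      have h1 := hoff n x (lt_of_le_of_lt hxR' (hRL n))
      have h2 : fderiv ℝ (radialProfile R (ε n)) x (v x) = 0 := fderiv_radialProfile_eq_zero hR (hε n) hxR' _
      have h3 : ∀ i, fderiv ℝ (χ n) x (stdOrthonormalBasis ℝ E3 i) = 0 := fun i => by rw [h1.1]; rfl
      have h4 : fderiv ℝ (χ n) x (v x) = 0 := by rw [h1.1]; rfl
      simp only [hF, hFcur, indicator_of_notMem (show x ∉ {x : E3 | R < ‖x‖} from hxR)]
      simp [testedRHS, h1.2, h2, h3, h4]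
  have hB : Tendsto (fun n => ∫ x, F n x) atTop (𝓝 (∫ x, Fcur x)) := by
    refine tendsto_integral_of_dominated_convergence _ (fun n => ?_)
      (integrable_dominator hflow hD hqc hq hR (ν / 2 * (R * C₂ + 6 * R * C₁)) (R * C₁ + R)
        (by positivity) (by positivity)) (fun n => Eventually.of_forall fun x => ?_)
      (Eventually.of_forall hF_lim)
    · exact (continuous_testedRHS hvc hqc (contDiff_radialProfile hR (hε n)) (hχ2 n)).aestronglyMeasurable
    · rw [Real.norm_eq_abs]
      exact abs_testedRHS_le hν v q hR (hε n) hC₁ (hRL n) (hχ n).2.2.1 (hDχ n) (hΔχ n) (hoff n) x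
  have := le_of_tendsto_of_tendsto' hA hB hab
  rwa [hFcur, integral_indicator_current] at this

/-- **Step (3.72)–(3.82) HOLDS — the typed binder `Step_382`**: for an `IsWuFlow` with `D(v) < ∞` and a
canonical pressure representative `p − c ∈ L^{9/4,∞}`, the physical current integral converges
absolutely (salvage-p3 g6's `integrableOn_current`) and `∫ Φ_R ν|∇v|² ≤ −R∫_{|x|>R} 𝒬 v·x|x|^{−3}`
(`cutoffEnergy_le_current382`). [cite: Wu2026, (3.72)–(3.82) p.23–25; Remark 3.5 p.26] -/
theorem step_382 : Step_382 := fun _ν hν _v _p hflow hD _c hq _R hR =>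
  ⟨integrableOn_current hflow hD hq hR, cutoffEnergy_le_current382 hν hflow hD hq hR⟩

end Summit.NavierStokesRegularity.NavierStokesRegularity.Theorems.Wu2026Salvage

end

-- WHAT THIS IS NOT: not a claim about NS regularity or blow-up; not a claim about any author beyond the typed locator.
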